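/-
HONEST FRAMING: certified error envelopes and provably optimal rounding/accumulation schemes for
low-precision formats under stated cost models; every table by two implementations; no hardware
or vendor claims.
-/
import Summits.Ventures.CertifiedArithmetic.LowPrec.OptDemotionRoutingNodeRule
import Summits.Ventures.CertifiedArithmetic.LowPrec.OptDemotionRoutingPairNode

/-!
# The demotion law (Theorem T8), part 11-0: (MC) and the B1 gap-convexity row with an ARBITRARY set of passive bits

The two families of rows used on the `b`-child by every branch of the Φ-hierarchy (lean seat gen 14,
HOME E-SIDE-TOPLEVEL.md §2–3, CONJECTURE-D-NODESTEP.md §G14.5), stated once for a general finite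
set `D` of passive offsets (the configuration is `{0} ∪ {-p : p ∈ D} ∪ {moving bit}`):
* `two_treeBR_cfg_le` — (MC) in the direction of the lowest bit `-i` (no run: `i - 1 ∉ D`):
  `2 BR({0} ∪ -D ∪ {-i}) ≤ BR({0} ∪ -D ∪ {-(i-1)}) + BR({0} ∪ -D)` (part 8h `treeBR_midconvex`);
* `treeBR_gcB1_cfg` — the scaled gap-convexity row of opt's LEMMA B1 with passive bits `D` all
  above the moving range: `(2 - 2·2^-n) BR(… ∪ {-(i+1)}) ≤ BR(… ∪ {-(i+n)}) + (1 - 2·2^-n) BR(… ∪ {-i})`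
  (part 10d `treeBR_gap_convex` with `S = {0} ∪ -D`: one gap).
Parts 10g/10i-0/10k-a′/10l-0 are the cases `|D| ≤ 2` written out; part 11 (the e-side for every
popcount) needs them for every `D`.
-/

namespace Summit.Ventures.CertifiedArithmetic.LowPrec.Opt

open Literature.ComputerArithmetic.JeannerodRump2018
open Literature.ComputerArithmetic.JeannerodRump2018.SumTree

section CfgRows

variable {q : ℕ}

/-- Membership in a configuration with passive bits. -/
theorem mem_cfg_iff {D : Finset ℕ} {S : Finset ℤ} {z : ℤ} :
    z ∈ insert (0 : ℤ) (S ∪ D.image (fun p : ℕ => -(p : ℤ))) ↔ z = 0 ∨ z ∈ S ∨ ∃ p ∈ D, -(p : ℤ) = z := by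
  simp only [Finset.mem_insert, Finset.mem_union, Finset.mem_image]

/-- Such a configuration is routable when everything lies in `[1-q, 0]`. -/
theorem routable_cfg (hq : 1 ≤ q) {D : Finset ℕ} {S : Finset ℤ} (hD : ∀ p ∈ D, 1 ≤ p ∧ p + 1 ≤ q)
    (hS : ∀ s ∈ S, 1 - (q : ℤ) ≤ s ∧ s ≤ 0) :
    Routable q (insert (0 : ℤ) (S ∪ D.image (fun p : ℕ => -(p : ℤ)))) := by
  have hb : ∀ z ∈ insert (0 : ℤ) (S ∪ D.image (fun p : ℕ => -(p : ℤ))), 1 - (q : ℤ) ≤ z ∧ z ≤ 0 := by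
    intro z hz
    rcases mem_cfg_iff.1 hz with h | h | ⟨p, hp, rfl⟩
    · have : (1 : ℤ) ≤ q := by exact_mod_cast hq
      omega
    · exact hS z h
    · have := hD p hp; omega
  have hw : (0 : ℤ) ≤ 1 - (q : ℤ) + ((q : ℤ) - 1) := by omega
  exact routable_of_bounds hb hw

/-- **(MC) WITH PASSIVE BITS**: for passive offsets `D` (all `≤ i - 2`) and `2 ≤ i ≤ q - 1`,
`2 BR({0} ∪ -D ∪ {-i}) ≤ BR({0} ∪ -D ∪ {-(i-1)}) + BR({0} ∪ -D)`. -/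
theorem two_treeBR_cfg_le (t : SumTree) {D : Finset ℕ} {i : ℕ} (hD : ∀ p ∈ D, 1 ≤ p ∧ p + 2 ≤ i)
    (hi2 : 2 ≤ i) (hiq : i + 1 ≤ q) :
    2 * treeBR q t (insert 0 ({-(i : ℤ)} ∪ D.image (fun p : ℕ => -(p : ℤ)))) ≤
      treeBR q t (insert 0 ({-((i : ℤ) - 1)} ∪ D.image (fun p : ℕ => -(p : ℤ)))) +
        treeBR q t (insert 0 (∅ ∪ D.image (fun p : ℕ => -(p : ℤ)))) := by
  classical
  set S : Finset ℤ := insert 0 ({-(i : ℤ)} ∪ D.image (fun p : ℕ => -(p : ℤ))) with hSdef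
  have hD' : ∀ p ∈ D, 1 ≤ p ∧ p + 1 ≤ q := fun p hp => ⟨(hD p hp).1, by have := hD p hp; omega⟩
  have hS : Routable q S := routable_cfg (by omega) hD' (fun s hs => by rw [Finset.mem_singleton] at hs; omega)
  have hrun : ∀ n : ℕ, n ≤ 0 → -(i : ℤ) + (n : ℤ) ∈ S := by
    intro n hn
    have : n = 0 := by omega
    subst this
    rw [hSdef, mem_cfg_iff]; right; left; simp
  have hβ' : -(i : ℤ) + (((0 : ℕ) : ℤ) + 1) ∉ S := by
    rw [hSdef, mem_cfg_iff]
    rintro (h | h | ⟨p, hp, hpe⟩)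
    · simp at h; omega
    · rw [Finset.mem_singleton] at h; simp at h
    · have := hD p hp; simp at hpe; omega
  have e1 : insert (-(i : ℤ) + (((0 : ℕ) : ℤ) + 1))
      (S \ (Finset.range (0 + 1)).image (fun n : ℕ => -(i : ℤ) + (n : ℤ))) =
        insert 0 ({-((i : ℤ) - 1)} ∪ D.image (fun p : ℕ => -(p : ℤ))) := by
    ext z
    simp only [hSdef, Nat.cast_zero, zero_add, Finset.range_one, Finset.image_singleton, add_zero,
      Finset.mem_insert, Finset.mem_sdiff, Finset.mem_singleton, Finset.mem_union, Finset.mem_image]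
    constructor
    · rintro (h | ⟨h1 | h1 | ⟨p, hp, rfl⟩, h2⟩)
      · right; left; omega
      · left; exact h1
      · exact absurd h1 h2
      · right; right; exact ⟨p, hp, rfl⟩
    · rintro (h | h | ⟨p, hp, rfl⟩)
      · right; exact ⟨Or.inl h, by omega⟩
      · left; omega
      · right; refine ⟨Or.inr (Or.inr ⟨p, hp, rfl⟩), ?_⟩
        have := hD p hp; omega
  have e2 : S.erase (-(i : ℤ)) = insert 0 (∅ ∪ D.image (fun p : ℕ => -(p : ℤ))) := by
    ext z
    simp only [hSdef, Finset.mem_erase, Finset.mem_insert, Finset.mem_union, Finset.mem_singleton,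
      Finset.mem_image, Finset.notMem_empty, false_or]
    constructor
    · rintro ⟨h1, h2 | h2 | ⟨p, hp, rfl⟩⟩
      · left; exact h2
      · exact absurd h2 h1
      · right; exact ⟨p, hp, rfl⟩
    · rintro (h | ⟨p, hp, rfl⟩)
      · exact ⟨by omega, Or.inl h⟩
      · have := hD p hp
        exact ⟨by omega, Or.inr (Or.inr ⟨p, hp, rfl⟩)⟩
  have hS' : Routable q (insert 0 ({-((i : ℤ) - 1)} ∪ D.image (fun p : ℕ => -(p : ℤ)))) :=
    routable_cfg (by omega) hD' (fun s hs => by rw [Finset.mem_singleton] at hs; omega)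
  have hmc := treeBR_midconvex (q := q) t hS (β := -(i : ℤ)) (j := 0) hrun hβ' (by rw [e1]; exact hS')
  rw [e1, e2] at hmc
  exact hmc

/-- **THE B1 GAP-CONVEXITY ROW WITH PASSIVE BITS** (scaled by `2·2^i`): for passive offsets `D`
(all `< i`), `1 ≤ i`, `2 ≤ n`, `i + n ≤ q - 1`:
`0 ≤ (-2 + 2·2^-n) BR(… ∪ {-(i+1)}) + BR(… ∪ {-(i+n)}) + (1 - 2·2^-n) BR(… ∪ {-i})`. -/
theorem treeBR_gcB1_cfg (t : SumTree) {D : Finset ℕ} {i n : ℕ} (hD : ∀ p ∈ D, 1 ≤ p ∧ p < i)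
    (hi : 1 ≤ i) (hn : 2 ≤ n) (hinq : i + n + 1 ≤ q) :
    0 ≤ (-2 + 2 * (2 : ℚ) ^ (-(n : ℤ))) * treeBR q t (insert 0 ({-((i : ℤ) + 1)} ∪ D.image (fun p : ℕ => -(p : ℤ)))) +
      (1) * treeBR q t (insert 0 ({-((i : ℤ) + n)} ∪ D.image (fun p : ℕ => -(p : ℤ)))) +
      (1 - 2 * (2 : ℚ) ^ (-(n : ℤ))) * treeBR q t (insert 0 ({-(i : ℤ)} ∪ D.image (fun p : ℕ => -(p : ℤ)))) := by
  classical
  set S : Finset ℤ := insert 0 (∅ ∪ D.image (fun p : ℕ => -(p : ℤ))) with hSdef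
  have hD' : ∀ p ∈ D, 1 ≤ p ∧ p + 1 ≤ q := fun p hp => ⟨(hD p hp).1, by have := hD p hp; omega⟩
  have pw : ∀ a b : ℤ, (2 : ℚ) ^ a * (2 : ℚ) ^ b = (2 : ℚ) ^ (a + b) := fun a b =>
    (zpow_add₀ (by norm_num) a b).symm
  have notin : ∀ e : ℤ, e ≤ -(i : ℤ) → e ∉ S := by
    intro e he h
    rw [hSdef, mem_cfg_iff] at h
    rcases h with h | h | ⟨p, hp, hpe⟩
    · omega
    · simp at h
    · have := hD p hp; omega
  have ins : ∀ e : ℤ, insert e S = insert 0 ({e} ∪ D.image (fun p : ℕ => -(p : ℤ))) := by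
    intro e; ext z
    simp only [hSdef, Finset.mem_insert, Finset.mem_union, Finset.mem_singleton, Finset.notMem_empty,
      false_or]
    tauto
  have hR : ∀ e : ℤ, 1 - (q : ℤ) ≤ e → e ≤ 0 → Routable q (insert e S) := by
    intro e h1 h2; rw [ins]
    exact routable_cfg (by omega) hD' (fun s hs => by rw [Finset.mem_singleton] at hs; omega)
  have h := treeBR_gap_convex (q := q) t (S := S) (m₁ := -((i : ℤ) + n)) (m₂ := -((i : ℤ) + 1))
    (m₃ := -(i : ℤ)) (by omega) (by omega) (notin _ (by omega)) (notin _ (by omega)) (notin _ le_rfl)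
    (by
      intro s hs
      rw [hSdef, mem_cfg_iff] at hs
      rcases hs with h | h | ⟨p, hp, rfl⟩
      · omega
      · simp at h
      · have := hD p hp; omega)
    (hR _ (by omega) (by omega)) (hR _ (by omega) (by omega)) (hR _ (by omega) (by omega))
  rw [ins, ins, ins] at h
  have w0 : (0 : ℚ) < (2 : ℚ) ^ (-(i : ℤ)) := zpow_pos (by norm_num) _
  have p1 : (2 : ℚ) ^ (-((i : ℤ) + n)) = (2 : ℚ) ^ (-(i : ℤ)) * (2 : ℚ) ^ (-(n : ℤ)) := by rw [pw]; congr 1; ring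
  have p2 : (2 : ℚ) ^ (-((i : ℤ) + 1)) = (2 : ℚ) ^ (-(i : ℤ)) * (1 / 2) := by
    rw [show (1 / 2 : ℚ) = (2 : ℚ) ^ (-1 : ℤ) by norm_num, pw]; congr 1; ring
  rw [p1, p2] at h
  set w := (2 : ℚ) ^ (-(i : ℤ)) with hw
  have h' : w * ((2 - 2 * (2 : ℚ) ^ (-(n : ℤ))) * treeBR q t (insert 0 ({-((i : ℤ) + 1)} ∪ D.image (fun p : ℕ => -(p : ℤ))))) ≤
      w * (treeBR q t (insert 0 ({-((i : ℤ) + n)} ∪ D.image (fun p : ℕ => -(p : ℤ)))) +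
        (1 - 2 * (2 : ℚ) ^ (-(n : ℤ))) * treeBR q t (insert 0 ({-(i : ℤ)} ∪ D.image (fun p : ℕ => -(p : ℤ))))) := by
    nlinarith [h, w0]
  have := le_of_mul_le_mul_left h' w0
  linarith only [this]

end CfgRows

end Summit.Ventures.CertifiedArithmetic.LowPrec.Opt
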